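import Mathlib
import HarnessLib
import Literature.NumberTheory.PAdicHodge.FontaineDpst
import Literature.NumberTheory.Automorphic.AdeleBaseChange
import Literature.NumberTheory.GaloisRepresentations.SorensenPatchingHypotheses
import Literature.NumberTheory.GaloisRepresentations.AbsGaloisGroupProofs
import Literature.NumberTheory.Automorphic.ReciprocityGLn

/-!
# `ReciprocityTRCM` (route BaseFieldAscent, crux stmt-Langlands-1093), line `pieces`:
# registered stub `stub_deRham_restrictField_pinned_of_local` — number-field plumbing 5G

The LOCAL base-change fact for de Rham-ness (Brinon–Conrad, Prop. 6.3.8: along a continuous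
embedding `K → L` of characteristic-`0` nonarchimedean local fields, a framed `ρ : Γ_K → GL_n(ℚ̄_ℓ)`
de Rham for Fontaine's pinned datum `fontainePst K ℓ _` restricts to a `ρ ∘ res_{L/K}` de Rham for
`fontainePst L ℓ _`; the neighbouring stub `stub_deRhamBaseChange_local`, here a HYPOTHESIS) implies
the GLOBAL statement the line consumes: if `ρ : Γ_F → GL_n(ℚ̄_ℓ)` is de Rham at every `v ∣ ℓ` of the
number field `F` for the summit's datum `fontainePstAdicCompletion v ℓ hv`, then for every finite
extension `E/F` the restriction `ρ|_{Γ_E}` is de Rham at every `w ∣ ℓ` of `E` for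
`fontainePstAdicCompletion w ℓ hw`.

Proof (pure plumbing, no `p`-adic Hodge theory beyond the hypothesis): put `v := w ∩ 𝓞 F`
(`HeightOneSpectrum.under`; `ℓ ∈ v`), `K := F_v`, `L := E_w` with the local base change
`K → L` (`adicCompletionOfUnder`, continuous, extending `F → E`). The hypothesis applied to
`ρ.toLocal v` gives de Rham-ness of `ρ ∘ res_{F_v/F} ∘ res_{E_w/F_v}`; the target is
`ρ ∘ res_{E/F} ∘ res_{E_w/E}`. Both composites `Γ_{E_w} → Γ_F` are conjugate to `res_{E_w/F}`
(`SorensenPatching.exists_absGaloisRestrict_absGaloisRestrict_eq_conj`, restriction between absolute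
Galois groups being canonical up to inner automorphisms), so the two framed representations differ
by a change of frame `FramedRep.conj (ρ τ)`, under which `IsDeRhamFramed` is invariant (a
`ℚ_ℓ`-model `HasQlModel` composes with `conj`).

References: O. Brinon, B. Conrad, *CMI Summer School notes on p-adic Hodge theory* (2009),
Prop. 6.3.8; J.-P. Serre, *Abelian ℓ-adic representations* (1968), Ch. I §2.1; J. S. Milne,
*Fields and Galois Theory*, Ch. 7.
-/

noncomputable section

set_option linter.dupNamespace false -- project-wide option; `Summit.Langlands.Langlands` is the mandated namespace

open scoped MatrixGroups NumberField
open IsDedekindDomain Field NumberField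
open Literature.NumberTheory.GaloisRepresentations Literature.NumberTheory.Automorphic
  Literature.NumberTheory.PAdicHodge

namespace Summit.Langlands.Langlands.Theorems.ReciprocityTRCM

/-- Iterated change of frame: `P (Q ρ Q⁻¹) P⁻¹ = (P Q) ρ (P Q)⁻¹`. [folklore] -/
private theorem conj_conj_eq_conj_mul' {G : Type*} [Group G] [TopologicalSpace G] {A : Type*}
    [CommRing A] [TopologicalSpace A] [IsTopologicalRing A] {n : ℕ} (P Q : GL (Fin n) A)
    (ρ : FramedRep G A n) : FramedRep.conj P (FramedRep.conj Q ρ) = FramedRep.conj (P * Q) ρ := by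
  ext g : 1
  simp only [FramedRep.conj_apply, _root_.mul_inv_rev]
  group

/-- **De Rham-ness does not see the frame**: `𝔇.IsDeRhamFramed ρ → 𝔇.IsDeRhamFramed (P ρ P⁻¹)`
(a `ℚ_ℓ`-model of `ρ`, `HasQlModel`, is one of `P ρ P⁻¹` after composing the change of frame).
[folklore] -/
private theorem isDeRhamFramed_conj' {K : Type} [Field K] [ValuativeRel K] [TopologicalSpace K]
    [IsNonarchimedeanLocalField K] {ℓ : ℕ} [Fact ℓ.Prime] (𝔇 : PstWeilDeligneData K ℓ) {n : ℕ}
    (P : GL (Fin n) (PadicAlgCl ℓ)) {ρ : FramedRep (absoluteGaloisGroup K) (PadicAlgCl ℓ) n}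
    (h : 𝔇.IsDeRhamFramed ρ) : 𝔇.IsDeRhamFramed (FramedRep.conj P ρ) := by
  obtain ⟨E, hE, rE, ⟨P₀, hP₀⟩, hdR⟩ := h
  exact ⟨E, hE, rE, ⟨P * P₀, by rw [← conj_conj_eq_conj_mul', hP₀]⟩, hdR⟩

/-- A rational prime in `w` lies in the place `w ∩ 𝓞 F` below `w` (local copy of
`natCast_mem_under` of the sibling file `…GoodCMQuadratic`). [folklore] -/
private theorem natCast_mem_under' {F : Type} [Field F] (E : Type) [Field E] [NumberField E]
    [Algebra F E] (w : HeightOneSpectrum (𝓞 E)) {q : ℕ} (hw : ((q : ℕ) : 𝓞 E) ∈ w.asIdeal) :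
    ((q : ℕ) : 𝓞 F) ∈ (w.under (𝓞 F)).asIdeal := by
  rw [HeightOneSpectrum.under_asIdeal, Ideal.under, Ideal.mem_comap, map_natCast]
  exact hw

/-- **Registered stub `stub_deRham_restrictField_pinned_of_local` of line `pieces`
(crux stmt-Langlands-1093): the local base-change fact for de Rham-ness (Brinon–Conrad Prop. 6.3.8,
hypothesis) implies that pinned de Rham-ness above `ℓ` passes from `ρ` over `F` to `ρ|_{Γ_E}` over a
finite extension `E`.** For `w ∣ ℓ` of `E` put `v := w ∩ 𝓞 F`; along the continuous local base change
`F_v → E_w` the hypothesis turns de Rham-ness of `ρ.toLocal v` into de Rham-ness of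
`ρ ∘ res_{F_v/F} ∘ res_{E_w/F_v}`, which differs from `(ρ|_{Γ_E}).toLocal w = ρ ∘ res_{E/F} ∘ res_{E_w/E}`
by the change of frame `ρ(τ)` for some `τ ∈ Γ_F` (both restriction composites `Γ_{E_w} → Γ_F` are
conjugate to `res_{E_w/F}`), and `IsDeRhamFramed` is frame-invariant.
[cite: BrinonConrad2009, Prop. 6.3.8] [cite: SerreAbelianLadic1968, Ch. I §2.1] -/
theorem stub_deRham_restrictField_pinned_of_local : (∀ (K L : Type) [Field K] [ValuativeRel K] [TopologicalSpace K] [IsNonarchimedeanLocalField K] [CharZero K] [Field L] [ValuativeRel L] [TopologicalSpace L] [IsNonarchimedeanLocalField L] [CharZero L] [Algebra K L], Continuous (algebraMap K L) → ∀ (ℓ : ℕ) [Fact ℓ.Prime] (hK : ValuativeRel.valuation K (ℓ : K) < 1) (hL : ValuativeRel.valuation L (ℓ : L) < 1) (n : ℕ) (ρ : Literature.NumberTheory.GaloisRepresentations.FramedRep (Field.absoluteGaloisGroup K) (PadicAlgCl ℓ) n), (Literature.NumberTheory.PAdicHodge.fontainePst K ℓ hK).IsDeRhamFramed ρ → (Literature.NumberTheory.PAdicHodge.fontainePst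 L ℓ hL).IsDeRhamFramed (ρ.comp (Literature.NumberTheory.GaloisRepresentations.absGaloisRestrict K L))) → ∀ (F : Type) [Field F] [NumberField F] (E : Type) [Field E] [NumberField E] [Algebra F E] (ℓ : ℕ) [Fact ℓ.Prime] (n : ℕ) (ρ : Literature.NumberTheory.GaloisRepresentations.FramedGaloisRep F (PadicAlgCl ℓ) n), (∀ (v : IsDedekindDomain.HeightOneSpectrum (NumberField.RingOfIntegers F)) (hv : ((ℓ : ℕ) : NumberField.RingOfIntegers F) ∈ v.asIdeal), (Literature.NumberTheory.PAdicHodge.fontainePstAdicCompletion v ℓ hv).IsDeRhamFramed (ρ.toLocal v)) → ∀ (w : IsDedekindDomain.HeightOneSpectrum (NumberField.RingOfIntegers E)) (hw : ((ℓ : ℕ) : NumberField.RingOfIntegers E) ∈ w.asIdeal), (Literature.NumberTheory.PAdicHodge.fontainePstAdicCompletion w ℓ hw).IsDeRhamFramed ((ρ.restrictField E).toLocal w) := by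
  intro hloc F _ _ E _ _ _ ℓ _ n ρ hρ w hw
  -- the place `v` of `F` below `w` and the local base change `F_v → E_w`
  set v : HeightOneSpectrum (𝓞 F) := w.under (𝓞 F) with hv_def
  have hv : ((ℓ : ℕ) : 𝓞 F) ∈ v.asIdeal := natCast_mem_under' E w hw
  haveI : CharZero (v.adicCompletion F) := LocalField.charZero_adicCompletion v
  haveI : CharZero (w.adicCompletion E) := LocalField.charZero_adicCompletion w
  letI alg : Algebra (v.adicCompletion F) (w.adicCompletion E) :=
    (adicCompletionOfUnder (𝓞 F) F E w).toAlgebra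
  haveI tower : IsScalarTower F (v.adicCompletion F) (w.adicCompletion E) := by
    refine IsScalarTower.of_algebraMap_eq fun x => ?_
    change ((algebraMap F E x : E) : w.adicCompletion E) =
      adicCompletionOfUnder (𝓞 F) F E w (x : v.adicCompletion F)
    rw [adicCompletionOfUnder_coe]
  -- the local fact applied to `ρ.toLocal v` along `F_v → E_w`
  have h1 := hloc (v.adicCompletion F) (w.adicCompletion E) (continuous_adicCompletionOfUnder F E w) ℓ
    (LocalField.valuation_adicCompletion_natCast_lt_one v ℓ hv)
    (LocalField.valuation_adicCompletion_natCast_lt_one w ℓ hw) n (ρ.toLocal v) (hρ v hv)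
  -- the two restriction composites `Γ_{E_w} → Γ_F` are conjugate to `res_{E_w/F}`
  obtain ⟨τ₁, hτ₁⟩ := SorensenPatching.exists_absGaloisRestrict_absGaloisRestrict_eq_conj F
    (v.adicCompletion F) (w.adicCompletion E)
  obtain ⟨τ₂, hτ₂⟩ := SorensenPatching.exists_absGaloisRestrict_absGaloisRestrict_eq_conj F E
    (w.adicCompletion E)
  have key : (ρ.restrictField E).toLocal w = FramedRep.conj (ρ (τ₂ * τ₁⁻¹))
      ((ρ.toLocal v).comp (absGaloisRestrict (v.adicCompletion F) (w.adicCompletion E))) := by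
    ext σ : 1
    change ρ (absGaloisRestrict F E (absGaloisRestrict E (w.adicCompletion E) σ)) =
      ρ (τ₂ * τ₁⁻¹) * ρ (absGaloisRestrict F (v.adicCompletion F)
        (absGaloisRestrict (v.adicCompletion F) (w.adicCompletion E) σ)) * (ρ (τ₂ * τ₁⁻¹))⁻¹
    rw [hτ₁ σ, hτ₂ σ]
    simp only [map_mul, map_inv]
    group
  rw [key]
  exact isDeRhamFramed_conj' _ _ h1

end Summit.Langlands.Langlands.Theorems.ReciprocityTRCM

end
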